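import Summits.NavierStokesRegularity.NavierStokesRegularity.Theses.QuarterJolt
import Summits.NavierStokesRegularity.NavierStokesRegularity.Theorems.QuarterJoltNoTerminalJoltRegularTime
import Summits.NavierStokesRegularity.NavierStokesRegularity.Theorems.QuarterJoltTypeIJoltLaw
import Summits.NavierStokesRegularity.NavierStokesRegularity.Theorems.QuarterJoltEnergyJumpLaw
import Summits.NavierStokesRegularity.NavierStokesRegularity.Theorems.QuarterJoltTypeIEnergyEqualityPosition
import Summits.NavierStokesRegularity.NavierStokesRegularity.Theorems.QuarterJoltEnstrophyRateEnergyEquality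
import Summits.NavierStokesRegularity.NavierStokesRegularity.Theorems.QuarterJoltNoEnergyAtom
import Summits.NavierStokesRegularity.NavierStokesRegularity.Theorems.QuarterJoltTypeIIEnergyEqualityEdges
import Summits.NavierStokesRegularity.NavierStokesRegularity.Theorems.QuarterJoltLocalJoltLaw
import Summits.NavierStokesRegularity.NavierStokesRegularity.Theorems.QuarterJoltCellJoltLaw
import Summits.NavierStokesRegularity.NavierStokesRegularity.Theorems.QuarterJoltLocalNoTerminalJolt
import Summits.NavierStokesRegularity.NavierStokesRegularity.Theorems.QuarterJoltLocalNoTerminalJoltEdges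
import Summits.NavierStokesRegularity.NavierStokesRegularity.Theorems.QuarterJoltNoFastEnergyConcentrationLocalEdges
import Summits.NavierStokesRegularity.NavierStokesRegularity.Theorems.QuarterJoltEnergyEqualityOfUI
import Summits.NavierStokesRegularity.NavierStokesRegularity.Theorems.QuarterJoltEnergyJumpPosition
import Summits.NavierStokesRegularity.NavierStokesRegularity.Theorems.QuarterJoltL4SliceTestCriterion
import Summits.NavierStokesRegularity.NavierStokesRegularity.Theorems.QuarterJoltWeakL4EnergyEquality
import Summits.NavierStokesRegularity.NavierStokesRegularity.Theorems.QuarterJoltShinbrotEnergyEquality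
import Summits.NavierStokesRegularity.NavierStokesRegularity.Theorems.QuarterJoltWeakL2MajorantCriterion
import Summits.NavierStokesRegularity.NavierStokesRegularity.Theorems.QuarterJoltEnstrophyQuarterLawEnergyEdges
import Summits.NavierStokesRegularity.NavierStokesRegularity.Theorems.QuarterJoltEnstrophyL4TradeOff
import Summits.NavierStokesRegularity.NavierStokesRegularity.Theorems.QuarterJoltDissipationRateEnergyEquality
import Summits.NavierStokesRegularity.NavierStokesRegularity.Theorems.QuarterJoltEnergyHalfHolderEdges
import HarnessLib.Audit

/-!
# Line `regular_split` on the crux `NoTerminalJolt` (stmt-NavierStokesRegularity-26463) — rev 8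

Crux X2 (FIXED, by name `Theses.QuarterJolt.NoTerminalJolt`): in the frame (classical on `[0,T)`,
Leray–Hopf on `[0,T]`, rapidly decaying datum) the jolt functional
`D(t) = (√(T−t))⁻¹ · ∫ ‖u(t) − u(T)‖²` tends to `0` as `t ↑ T` — for EVERY `T > 0`.

The quantifier `∀ T > 0` ranges over ALL positive times (refuter audit refuter1-g10, 2026-08-28). The
crux therefore splits along `HasSmoothExtensionPast ν 0 u T` (regular time / first blow-up time); the
blow-up half splits along the blow-up TYPE `IsTypeIBlowup u T` (rev 3, LEAD ns-ntj-p1 g2, after the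
TYPE-I TERMINAL JOLT LAW `NoTerminalJolt.typeI_terminalJoltLaw`, `Theorems/QuarterJoltTypeIJoltLaw.lean`);
and — rev 4, LEAD ns-ntj-p1 g3, after the ENERGY-JUMP LAW `NoTerminalJolt.exists_energyJump`
(`Theorems/QuarterJoltEnergyJumpLaw.lean`: in the frame `∫‖u(t) − u(T)‖² → J`, the energy jump at `T`;
`D → 0 ⇒ J = 0`; `J > 0 ⇒ D → +∞`) — the Type-II half splits once more into its `α = 0` member (NO
ENERGY JUMP at a non-Type-I first blow-up = the energy equality at the blow-up time, answering
KEY-NS #102 (2): yes, this content is INSIDE the crux, and here it is isolated) and the RATE given no jump: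

REV 5 (LEAD ns-ntj-p1 g4, after the TYPE-I ENERGY EQUALITY, `Theorems/QuarterJoltTypeIEnergyEquality.lean`:
in the frame, the sup-norm Type-I rate at `T` forces `‖u(t) − u(T)‖_{L²} → 0` — Leslie–Shvydkoy 2018
Thm. 1.2 / Cheskidov–Luo 2020 Cor. 1.2, here by slice testing: the momentum equation on `(t,T)` tested
against the frozen regular slice `u(t)`, transport integrated by parts onto `u(t)`, giving the TYPE-I
TERMINAL APPROACH LAW `∫‖u(t) − u(T)‖² ≤ (ν/2)w + 4C√(2E₀)√w`, `w = (T−t)∫|Du(t)|²_F`, and `w → 0`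
along a sequence by finite dissipation): the stubs are UNCHANGED, but stub 3 is now EXACTLY «no energy
jump at ANY first blow-up of the frame» (`typeIIEnergyEquality_iff_energyEqualityAtBlowup`,
`Theorems/QuarterJoltTypeIEnergyEqualityPosition.lean`), and a Type-I first blow-up — if one existed —
would be a JUMP-FREE JOLT (`typeI_jumpFree_jolt`: energy continuous at `T`, jolt functional `↛ 0`).
The same slice testing in `H¹` form (transport through `L⁴` + Ladyzhenskaya;
`Theorems/QuarterJoltEnstrophyRateEnergyEquality.lean`) gives the ENSTROPHY-RATE ENERGY EQUALITY: a
first blow-up with `∫|Du(t)|²_F ≤ M(T−t)^{−α}` near `T`, `α < 4/5` (Leray / EQL: `α = 1/2`), has no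
energy jump either (`tendsto_eLpNorm_sub_of_enstrophyRate`; in print inside the `L³B^{1/3}_{3,∞}`
class, CCFS 2008 / Cheskidov–Luo 2020 §2.2). So stub 3 lives exactly at first blow-ups that are
NEITHER sup-norm Type I NOR enstrophy-mild (`typeIIEnergyEquality_iff_enstrophyHeavy`): an
energy-carrying collapse with enstrophy beyond `(T−t)^{−4/5}` along a sequence. TYPED EDGES of stub 3
(`Theorems/QuarterJoltTypeIIEnergyEqualityEdges.lean`, `…NoEnergyAtom.lean`): stub 3 ⟺ «every frame
solution is strongly `L²`-continuous into its terminal time» ⟹ Leray's energy equality on every closed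
frame interval ⟹ `HodographBetchov.NoFastEnergyConcentration` (stmt-18118) BY NAME ⟹ the statement of
WeakLambdaCriterion's `stub_noEnergyAtom` (crux stmt-19625) verbatim.

REV 6 (LEAD ns-ntj-p1 g5): the stubs are UNCHANGED; two sorry-free facts are added about WHERE the
Type-I half lives and HOW MUCH of the crux the route consumes. (i) THE CELL / LOCAL TYPE-I JOLT LAW
(`Theorems/QuarterJoltLocalJoltLaw.lean`, `Theorems/QuarterJoltCellJoltLaw.lean`): in the frame with
the Type-I rate at `T`, at a singular vertex `(T, x₀)` there is ONE `δ > 0` such that EVERY parabolic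
cell `Q_ρ(T, x₀)` contains a slice `t ∈ (T−ρ², T)` with `∫_{B_ρ(x₀)}‖u(t) − u(T)‖² ≥ δ√(T−t)`
(`NoTerminalJolt.typeI_cellJoltLaw`; fixed balls: `typeI_localJoltLaw`, for every `R > 0` the local jolt
functional `D_R(t; x₀) = (√(T−t))⁻¹∫_{B_R(x₀)}‖u(t) − u(T)‖²` does not tend to `0`) — the self-similar
`L²` approach of a Type-I blow-up to its terminal value is CONCENTRATED AT the singular points, at every
scale (the TIME face of CKN's «`A(r) ≥ ε` at all scales»). (ii) THE LOCAL FORM OF THE CRUX SUFFICES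
(`Theorems/QuarterJoltLocalNoTerminalJolt.lean`): with `LocalNTJ := «in the frame, ∀ x₀ ∃ R > 0,
D_R(·; x₀) → 0»` (spelled out inline; `NTJ ⇒ LocalNTJ`), `EnstrophyQuarterLaw ∧ LocalNTJ ⇒ Clay (A)` and
`NoTypeII (0056) ∧ LocalNTJ ⇒ NoBlowup (0054)` — the route's assembly goes through with its second crux
weakened to the pointwise-local statement (a planner's option; nothing is filed here). The zero-width
booking is unchanged: LocalNTJ is still false at every Type-I first blow-up. The typed edges to
shelf items survive the weakening (`Theorems/QuarterJoltLocalNoTerminalJoltEdges.lean`): `LocalNTJ ⇒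
NoTypeIBlowup (1217)` verbatim (even the cell form does) and `LocalNTJ ⇒` WeakLambdaCriterion's
`stub_noEnergyAtom` (crux 19625) verbatim; the edge to 18118 (uniform integrability) uses the global functional.
(iii) THE LOCAL CONVERSE OF «stub 3 ⇒ 18118» (`Theorems/QuarterJoltLocalEnergyContinuityOfUI.lean`): in
the frame, UNIFORMLY INTEGRABLE energy near `T` (18118's conclusion for the flow) forces
`∫_{B(x₀,R)}‖u(t) − u(T)‖² → 0` for every `x₀, R` (CKN `ℋ¹`-null top singular set, Federer covers of
small volume, absolute continuity, regular-point convergence — the nsreg-C26 CKN-slice route with the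
Morrey bound replaced by uniform integrability): 18118 ⇒ LOCAL stub 3 and 18118 ⇒ 19625's
`stub_noEnergyAtom`; the gap between stub 3 and 18118 is exactly TIGHTNESS of `|u(t)|²` at spatial
infinity as `t ↑ T`.

REV 7 (LEAD ns-ntj-p1 g5, same session): STUB 3 IS RESHAPED INTO A SHELF STATEMENT. With the
TIGHTNESS of the energy at spatial infinity in the frame (`Theorems/QuarterJoltFrameTightness.lean`:
Leray's far-field estimate via the local energy identity with dilated cut-offs and the quantitative
flux bound of `Theorems/QuarterJoltFrameFluxBound.lean`) the local converse (iii) becomes global: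
uniformly integrable energy ⇒ `∫‖u(t) − u(T)‖² → 0` (`Theorems/QuarterJoltEnergyEqualityOfUI.lean`),
so the former stub 3 «energy equality at every (non-Type-I) first blow-up» is EQUIVALENT to shelf
statement stmt-18118 `HodographBetchov.NoFastEnergyConcentration`
(`typeIIEnergyEquality_iff_noFastEnergyConcentration`). The skeleton's third stub is therefore now
`stub_noFastEnergyConcentration` = stmt-18118 VERBATIM (exactly as stub 2 = stmt-1217 verbatim), and
  `NoTerminalJolt ⟺ NoTypeIBlowup (1217) ∧ NoFastEnergyConcentration (18118) ∧ TypeIIRate`: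
the crux is the conjunction of TWO EXISTING SHELF ITEMS and the rate residue `stub_typeIIRate`.

REV 8 (LEAD ns-ntj-p1 g6): the stubs are UNCHANGED; the energy half (stub 3 = 18118) gets its
ENVELOPE THEOREM. THE `L⁴` SLICE-TEST CRITERION (`Theorems/QuarterJoltSliceTestIncrementL4.lean`
p652191, `Theorems/QuarterJoltL4SliceTestCriterion.lean` p652789): in the frame,
`∫ₜᵀ ‖u(τ)‖²_{L⁴} dτ ≤ C√(T−t)` for `t < T` near `T` ⇒ NO ENERGY JUMP at `T`
(`NoTerminalJolt.tendsto_integral_norm_sub_sq_of_l4Criterion`; the `L⁴` TERMINAL APPROACH LAW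
`∫‖u(t) − u(T)‖² ≤ (ν/2)(T−t)Z(t) + 2‖Du(t)‖₂∫ₜᵀ‖u‖²_{L⁴}`, scale-free enstrophy small frequently,
energy-jump law; master form `…_of_frequently_l4Bound_lt`). Instances, all landed:
the WEAK-`L⁴` RATE `∫‖u(t)‖⁴ ≤ M/(T−t)` (`Theorems/QuarterJoltWeakL4EnergyEquality.lean` p653319 —
the `p = 4` ENDPOINT of Cheskidov–Luo, Nonlinearity 33 (2020) Cor. 1.2, which needs `p > 4`; it
contains rev 5's sup-norm Type-I theorem, `weakL4Rate_of_isTypeIBlowup`), the weak `L^p` rates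
`‖u(t)‖_p ≲ (T−t)^{−(1/2−1/p)}`, `p ≥ 4`, SHINBROT'S class `L^q_tL^p_x`, `1/q + 1/p ≤ 1/2`, `p ≥ 4`,
and LIONS' `L⁴L⁴` at a first blow-up time (`Theorems/QuarterJoltShinbrotEnergyEquality.lean` p654094,
by `L²`–`L^p` interpolation and Hölder in time); and the WEAK-`L²`-IN-TIME MAJORANT CRITERION
(`Theorems/QuarterJoltWeakL2MajorantCriterion.lean` p654851: `‖u(τ)‖²_{L⁴} ≤ m(τ)`,
`m ∈ L^{2,w}(t₀,T)` ⇒ no jump, by the layer-cake bound `∫_A m ≤ 2N|A|^{1/2}`), whose corollaries are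
`‖u(·)‖_{L⁴} ∈ L^{4,w}(t₀,T)` (the `β = p = 4` corner of Cheskidov–Luo Thm. 1.1, excluded there) and
INTERMITTENT TYPE I (a sup-norm majorant in `L^{2,w}(t₀,T)`, Cheskidov–Luo Thm. 1.1 at `p = ∞`;
strong endpoint `L²_tL^∞_x`; the `L^{4,w}_tL⁴_x` case is the time-weak, space-strong face of the
problem flagged OPEN for Leray–Hopf solutions in Wang–Wei–Ye, arXiv:2106.11212, Rem. 1.9
(`L^{4,∞}_tL^{4,∞}_x`), here settled at a first blow-up time of the frame). THE FIRST CRUX DECIDES THE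
ENERGY HALF (`Theorems/QuarterJoltEnstrophyQuarterLawEnergyEdges.lean` p655816): `EnstrophyQuarterLaw
(stmt-1574) ⇒ NoFastEnergyConcentration (stmt-18118)` BY NAME (every first blow-up is then Type I and
Type-I blow-ups do not jump), and `EnstrophyQuarterLaw → (NoTerminalJolt ↔ NoTypeIBlowup)`: GIVEN THE
ROUTE'S FIRST CRUX, THIS CRUX IS EXACTLY SHELF ITEM 1217 (`stub_noTypeIBlowup`). THE DISSIPATION-TAIL
THEOREM (`Theorems/QuarterJoltDissipationRateEnergyEquality.lean` p657007, `…EnergyHalfHolderEdges`):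
`∫ₜᵀ∫|Du|²_F ≤ K(T−t)^γ` near `T` with `γ > 1/5` (⟸ energy `γ`-Hölder at `T⁻`) ⇒ no energy jump —
the integrated, intermittency-tolerant form of rev 5 (`γ = 1−α`), whose case `γ = 1/2` is the window
quarter law `EnergyHalfHolder` of route HalfHolderEnergy: `EnergyHalfHolder (stmt-25161) ⇒
NoFastEnergyConcentration (stmt-18118)` BY NAME; and the ENSTROPHY–`L⁴` TRADE-OFF LAW
(`Theorems/QuarterJoltEnstrophyL4TradeOff.lean` p656357: rate `α < 1` plus `L⁴` tail exponent
`β > α/2` ⇒ no jump). POSITION: stub 3 ⟺ «no energy jump at `L⁴`-HEAVY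
first blow-ups» — those with `∫‖u(t)‖⁴ ≤ M/(T−t)` near `T` for NO `M`, i.e. carrying more than the
SQUARE of the self-similar `L⁴` mass along a sequence (`stub_typeIIEnergyEquality_iff_l4Heavy`).

* `stub_regularTime` — "RegularTimeJolt" (CLOSED, p619494, `Theorems.NoTerminalJolt.stub_regularTime`):
  at a time past which the solution extends smoothly, `D → 0` (in fact `O((T−t)^{3/2})`).
* `stub_noTypeIBlowup` — THE TYPE-I HALF = shelf statement stmt-NavierStokesRegularity-1217
  `NoTypeIBlowup` VERBATIM (open-XL, wanted by ≥ 12 routes): in the frame, a solution blowing up at most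
  at the Type-I rate at `T` extends smoothly past `T`. Exactly the Type-I half of the crux by
  `typeI_terminalJoltLaw` (every Type-I FIRST blow-up in the frame JOLTS); converse packaging
  `noTypeIBlowup_of_noTerminalJolt : NoTerminalJolt → ‹1217›` (landed).
* `stub_typeIIEnergyEquality` — THE `α = 0` MEMBER OF THE TYPE-II HALF (open): a first blow-up in the
  frame which is NOT Type I has NO ENERGY JUMP at `T`: `‖u(t) − u(T)‖_{L²} → 0` as `t ↑ T` (strong
  `L²`-continuity into `T`; for a Leray–Hopf solution ⟺ `∫‖u(t)‖² → ∫‖u(T)‖²`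
  (`QuarterJoltEnergyJumpLaw`) ⟺ LERAY'S ENERGY EQUALITY on the closed interval,
  `E(u T) + ν∫₀ᵀ∫|∇u|² = E(u 0)` (`NoTerminalJolt.tendsto_eLpNorm_sub_iff_energyEquality`,
  `QuarterJoltEnergyJumpDefect`, p632964: the energy jump IS the defect in Leray's energy inequality
  at `T`). In print the energy equality at a first blow-up time is known
  ONLY under Type-I-in-time or `L^qL^p` hypotheses (Leslie–Shvydkoy, ARMA 230 (2018) Thm. 1.2; Lions /
  Shinbrot / Kukavica / Cheskidov–Luo classes), so this stub is an open problem of its own; it implies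
  the shelf statement stmt-18118 `HodographBetchov.NoFastEnergyConcentration` restricted to non-Type-I
  blow-ups (landed `FastClassSqueeze.Birth.stub_no_fast_energy_concentration_of_tendsto`), and the crux
  implies 18118 outright (`noFastEnergyConcentration_of_noTerminalJolt`, companion file
  `QuarterJoltEnergyJumpPosition.lean`). Why it might fail: an energy-carrying strongly Type-II
  collapse onto the `ℋ¹`-null singular set `Σ_T` (the scenario named in 18118's record); nothing in
  print excludes it. REV 5: the Type-I case of this statement is a THEOREM
  (`tendsto_eLpNorm_sub_of_isTypeIBlowup`, `QuarterJoltTypeIEnergyEquality`), so the hypothesis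
  `¬ IsTypeIBlowup u T` is a convenience, not a restriction: the stub ⟺ «Leray's energy equality on
  `[0,T]` at EVERY first blow-up time `T` of the frame».
* `stub_typeIIRate` — THE RATE (open; the genuine residue of this line): a non-Type-I first blow-up in
  the frame WITH the energy equality at `T` approaches `u(T)` at `o((T−t)^{1/4})` in `L²`, i.e. `D → 0`.
  Why it might fail: a non-Type-I blow-up with no energy jump but a `√(T−t)`-sized (or larger) `L²`
  remainder; vacuous under `NoTypeII` (stmt-0056). Calibration (`QuarterJoltRateCaricature`, p630026):
  every rate-γ caricature has no energy jump, and jolts iff `γ ≤ 1/2` (Type-I rate) — so in the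
  caricature family this stub HOLDS; its content is «a genuine Type-II blow-up sheds no `√(T−t)`-sized
  `L²` radiation». STRUCTURE (g3): at a first blow-up the energy drop is self-similar-sized
  (`energyDrop_ge_sqrt`, `QuarterJoltTerminalPairingLaw` p633723), so `D → 0` is a CANCELLATION law for
  the pairing `∫⟪u(t) − u(T), u(T)⟫` (`terminalPairingLaw`); in particular a first blow-up whose
  terminal value is a REGULAR field (smooth, bounded, divergence free, `Du(T) ∈ L²`) JOLTS
  (`jolt_of_regularTerminalValue`, `QuarterJoltRegularTerminalValueJolts` p635366): this stub asserts,
  among other things, that Type-II blow-ups leave ROUGH terminal profiles.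

The composition `NoTerminalJolt_of` is the triple case split; all difficulty sits in the three open
stubs, none is hidden. EXACTNESS (companion file `QuarterJoltEnergyJumpPosition.lean`):
`NoTerminalJolt ⟺ stub_noTypeIBlowup ∧ stub_typeIIEnergyEquality ∧ stub_typeIIRate`
(`NoTerminalJolt.iff_noTypeIBlowup_and_typeIIEnergyEquality_and_typeIIRate`). POSITION (kernel-hard):
`NoBlowup (0054) ⇒ NTJ ⇒ NoTypeIBlowup (1217)`, `NTJ ⇒ energy equality at every frame time ⇒
NoFastEnergyConcentration (18118)`, `Type-I rate at T ⇒ energy equality at T` (rev 5, a THEOREM),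
`NTJ ∧ NoTypeII (0056) ⇒ NoBlowup ⇒ Clay (A)`. No summit
statement and no crux is proved by this line; NS regularity, `EnstrophyQuarterLaw` (1574),
`NoTerminalJolt` (26463), `NoTypeIBlowup` (1217), `NoFastEnergyConcentration` (18118), `NoTypeII`
(0056) stay OPEN.
-/

namespace Summit.NavierStokesRegularity.NavierStokesRegularity.Cruxes.NoTerminalJolt.RegularSplit

-- the summit and its single sub-problem share the name (CONVENTIONS §1)
set_option linter.dupNamespace false

open MeasureTheory Filter Topology
open Literature.Analysis.FluidPDE

/-- **stub 1 — `stub_regularTime` = `RegularTimeJolt` (M, CLOSED — p619494; landed as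
`Theorems.NoTerminalJolt.stub_regularTime` in `Theorems/QuarterJoltNoTerminalJoltRegularTime.lean`:
Tao 2013 Cor. 11.1 on the closed slab + Majda–Bertozzi Thm. 3.5 `L²`-Lipschitz continuity in the BKM
class + identification of the Leray–Hopf terminal value with the smooth one).** At a time `T` past
which the classical solution extends smoothly, the jolt functional tends to `0`. -/
theorem stub_regularTime :
    ∀ (ν T : ℝ), 0 < ν → 0 < T → ∀ (u : ℝ → EuclideanSpace ℝ (Fin 3) → EuclideanSpace ℝ (Fin 3))
      (p : ℝ → EuclideanSpace ℝ (Fin 3) → ℝ), IsClassicalNSSolutionOn (Set.Ico 0 T) ν 0 u p →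
      IsLerayHopfOn T ν 0 (u 0) u → HasRapidSpatialDecay (u 0) → HasSmoothExtensionPast ν 0 u T →
      Filter.Tendsto (fun t : ℝ => (Real.sqrt (T - t))⁻¹ * ∫ x, ‖u t x - u T x‖ ^ 2)
        (nhdsWithin T (Set.Iio T)) (nhds 0) :=
  -- CLOSED 2026-08-28 (p619494, ns-ntj-p1 g0): the landed theorem, verbatim signature.
  Summit.NavierStokesRegularity.NavierStokesRegularity.Theorems.NoTerminalJolt.stub_regularTime

/-- **stub 2 — `stub_noTypeIBlowup` = shelf statement stmt-NavierStokesRegularity-1217 `NoTypeIBlowup`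
VERBATIM (XL, OPEN — the Type-I half of the crux at first blow-up times: by the landed Type-I terminal
jolt law a maximal Type-I solution in the frame jolts, so the crux holds at Type-I blow-up times iff
there are none; why it might fail: Type-I exclusion is open beyond axisymmetry (KNSS 2009,
Seregin–Šverák 2009), the bounded-ancient-solution Liouville conjecture may fail, barrier
`AveragedTypeIBlowup`).** In the frame, a solution with the Type-I rate at `T` extends past `T`. -/
theorem stub_noTypeIBlowup :
    ∀ (ν T : ℝ), 0 < ν → 0 < T → ∀ (u : ℝ → EuclideanSpace ℝ (Fin 3) → EuclideanSpace ℝ (Fin 3))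
      (p : ℝ → EuclideanSpace ℝ (Fin 3) → ℝ), IsClassicalNSSolutionOn (Set.Ico 0 T) ν 0 u p →
      IsLerayHopfOn T ν 0 (u 0) u → HasRapidSpatialDecay (u 0) → IsTypeIBlowup u T →
      HasSmoothExtensionPast ν 0 u T := by
  sorry

/-- **stub 3 — `stub_noFastEnergyConcentration` = shelf statement stmt-NavierStokesRegularity-18118
`HodographBetchov.NoFastEnergyConcentration` VERBATIM (L–XL, OPEN — rev 7 reshape of the former
`stub_typeIIEnergyEquality` «a non-Type-I first blow-up in the frame has no energy jump at `T`», to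
which it is EQUIVALENT (`Theorems.typeIIEnergyEquality_iff_noFastEnergyConcentration`, via CKN partial
regularity at the top slice + Leray's far-field tightness): the kinetic energy of every frame solution
is uniformly integrable over speed classes up to `T`; why it might fail: an energy-carrying strongly
Type-II collapse onto the `ℋ¹`-null top singular set `Σ_T`; wanted by route HodographBetchov as leaf X₁
of `FastClassSqueeze`).** -/
theorem stub_noFastEnergyConcentration :
    ∀ (ν T : ℝ), 0 < ν → 0 < T → ∀ (u : ℝ → EuclideanSpace ℝ (Fin 3) → EuclideanSpace ℝ (Fin 3))
      (p : ℝ → EuclideanSpace ℝ (Fin 3) → ℝ),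
      Literature.Analysis.FluidPDE.IsClassicalNSSolutionOn (Set.Ico 0 T) ν 0 u p →
      Literature.Analysis.FluidPDE.IsLerayHopfOn T ν 0 (u 0) u →
      Literature.Analysis.FluidPDE.HasRapidSpatialDecay (u 0) → ∀ ε : ℝ, 0 < ε → ∃ l : ℝ, 0 < l ∧
      ∀ t ∈ Set.Ico 0 T, ∫⁻ x in {x : EuclideanSpace ℝ (Fin 3) | l < ‖u t x‖}, ‖u t x‖ₑ ^ 2 ≤
        ENNReal.ofReal ε := by
  sorry

/-- **The former stub 3 (`stub_typeIIEnergyEquality`, rev 4–6) follows from the new one** (landed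
`Theorems.typeIIEnergyEquality_of_noFastEnergyConcentration`): a non-Type-I first blow-up in the frame
has no energy jump at `T`. Kept as a named step of the composition. -/
theorem stub_typeIIEnergyEquality :
    ∀ (ν T : ℝ), 0 < ν → 0 < T → ∀ (u : ℝ → EuclideanSpace ℝ (Fin 3) → EuclideanSpace ℝ (Fin 3))
      (p : ℝ → EuclideanSpace ℝ (Fin 3) → ℝ), IsMaximalSmoothSolution ν 0 u p T →
      IsLerayHopfOn T ν 0 (u 0) u → HasRapidSpatialDecay (u 0) → ¬ IsTypeIBlowup u T →
      Filter.Tendsto (fun t => MeasureTheory.eLpNorm (u t - u T) 2 MeasureTheory.volume)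
        (nhdsWithin T (Set.Iio T)) (nhds 0) :=
  Summit.NavierStokesRegularity.NavierStokesRegularity.Theorems.typeIIEnergyEquality_of_noFastEnergyConcentration
    stub_noFastEnergyConcentration

/-- **stub 4 — `stub_typeIIRate` = `TypeIIRate` (XL, OPEN — the residue of this line: a non-Type-I
first blow-up in the frame WITH the energy equality at `T` (no energy jump) has no terminal jolt,
`D → 0`; why it might fail: a `√(T−t)`-sized `L²` remainder without energy jump; vacuous under `NoTypeII`
(stmt-0056); holds in the whole rate-γ caricature family, `QuarterJoltRateCaricature`).** -/
theorem stub_typeIIRate :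
    ∀ (ν T : ℝ), 0 < ν → 0 < T → ∀ (u : ℝ → EuclideanSpace ℝ (Fin 3) → EuclideanSpace ℝ (Fin 3))
      (p : ℝ → EuclideanSpace ℝ (Fin 3) → ℝ), IsMaximalSmoothSolution ν 0 u p T →
      IsLerayHopfOn T ν 0 (u 0) u → HasRapidSpatialDecay (u 0) → ¬ IsTypeIBlowup u T →
      Filter.Tendsto (fun t => MeasureTheory.eLpNorm (u t - u T) 2 MeasureTheory.volume)
        (nhdsWithin T (Set.Iio T)) (nhds 0) →
      Filter.Tendsto (fun t : ℝ => (Real.sqrt (T - t))⁻¹ * ∫ x, ‖u t x - u T x‖ ^ 2)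
        (nhdsWithin T (Set.Iio T)) (nhds 0) := by
  sorry

/-- **The skeleton theorem** — concludes the crux `Theses.QuarterJolt.NoTerminalJolt` BY NAME, no
hypotheses: case split on `HasSmoothExtensionPast ν 0 u T`, then on `IsTypeIBlowup u T`; the four stubs
used by name (the Type-I blow-up case is absurd: `stub_noTypeIBlowup` extends the solution; in the
Type-II case `stub_noFastEnergyConcentration` — through `stub_typeIIEnergyEquality` — feeds `stub_typeIIRate`). -/
theorem NoTerminalJolt_of : Theses.QuarterJolt.NoTerminalJolt := by
  intro ν T hν hT u p hcl hLH hdec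
  by_cases hext : HasSmoothExtensionPast ν 0 u T
  · exact stub_regularTime ν T hν hT u p hcl hLH hdec hext
  · by_cases hTI : IsTypeIBlowup u T
    · exact absurd (stub_noTypeIBlowup ν T hν hT u p hcl hLH hdec hTI) hext
    · exact stub_typeIIRate ν T hν hT u p ⟨hcl, hext⟩ hLH hdec hTI
        (stub_typeIIEnergyEquality ν T hν hT u p ⟨hcl, hext⟩ hLH hdec hTI)

/-! ### Why the split is exact (sorry-free consequences of the tree, recorded for the registry's readers) -/

/-- **The Type-I half is item 1217, conversely**: the crux BY NAME implies `stub_noTypeIBlowup`'s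
statement (landed `Theorems.noTypeIBlowup_of_noTerminalJolt`, via the Type-I terminal jolt law). -/
theorem stub_noTypeIBlowup_of_noTerminalJolt (h : Theses.QuarterJolt.NoTerminalJolt) :
    ∀ (ν T : ℝ), 0 < ν → 0 < T → ∀ (u : ℝ → EuclideanSpace ℝ (Fin 3) → EuclideanSpace ℝ (Fin 3))
      (p : ℝ → EuclideanSpace ℝ (Fin 3) → ℝ), IsClassicalNSSolutionOn (Set.Ico 0 T) ν 0 u p →
      IsLerayHopfOn T ν 0 (u 0) u → HasRapidSpatialDecay (u 0) → IsTypeIBlowup u T →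
      HasSmoothExtensionPast ν 0 u T :=
  Summit.NavierStokesRegularity.NavierStokesRegularity.Theorems.noTypeIBlowup_of_noTerminalJolt h

/-- **The `α = 0` member, conversely**: the crux BY NAME implies `stub_typeIIEnergyEquality`'s statement
(the energy-jump law: `D → 0` forces strong `L²`-continuity into `T`, landed
`Theorems.NoTerminalJolt.tendsto_eLpNorm_sub_of_tendsto_joltFunctional`). -/
theorem stub_typeIIEnergyEquality_of_noTerminalJolt (h : Theses.QuarterJolt.NoTerminalJolt) :
    ∀ (ν T : ℝ), 0 < ν → 0 < T → ∀ (u : ℝ → EuclideanSpace ℝ (Fin 3) → EuclideanSpace ℝ (Fin 3))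
      (p : ℝ → EuclideanSpace ℝ (Fin 3) → ℝ), IsMaximalSmoothSolution ν 0 u p T →
      IsLerayHopfOn T ν 0 (u 0) u → HasRapidSpatialDecay (u 0) → ¬ IsTypeIBlowup u T →
      Filter.Tendsto (fun t => MeasureTheory.eLpNorm (u t - u T) 2 MeasureTheory.volume)
        (nhdsWithin T (Set.Iio T)) (nhds 0) :=
  fun ν T hν hT u p hmax hLH hdec _ =>
    Summit.NavierStokesRegularity.NavierStokesRegularity.Theorems.NoTerminalJolt.tendsto_eLpNorm_sub_of_tendsto_joltFunctional
      hT hLH (h ν T hν hT u p hmax.1 hLH hdec)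

/-- **The rate, conversely**: the crux BY NAME implies `stub_typeIIRate`'s statement (drop three
hypotheses). So `NoTerminalJolt ⟺ stub_noTypeIBlowup ∧ stub_typeIIEnergyEquality ∧ stub_typeIIRate`
(given the theorem `stub_regularTime`), i.e. the reshaped skeleton loses nothing
(`Theorems.NoTerminalJolt.iff_noTypeIBlowup_and_typeIIEnergyEquality_and_typeIIRate`). -/
theorem stub_typeIIRate_of_noTerminalJolt (h : Theses.QuarterJolt.NoTerminalJolt) :
    ∀ (ν T : ℝ), 0 < ν → 0 < T → ∀ (u : ℝ → EuclideanSpace ℝ (Fin 3) → EuclideanSpace ℝ (Fin 3))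
      (p : ℝ → EuclideanSpace ℝ (Fin 3) → ℝ), IsMaximalSmoothSolution ν 0 u p T →
      IsLerayHopfOn T ν 0 (u 0) u → HasRapidSpatialDecay (u 0) → ¬ IsTypeIBlowup u T →
      Filter.Tendsto (fun t => MeasureTheory.eLpNorm (u t - u T) 2 MeasureTheory.volume)
        (nhdsWithin T (Set.Iio T)) (nhds 0) →
      Filter.Tendsto (fun t : ℝ => (Real.sqrt (T - t))⁻¹ * ∫ x, ‖u t x - u T x‖ ^ 2)
        (nhdsWithin T (Set.Iio T)) (nhds 0) :=
  fun ν T hν hT u p hmax hLH hdec _ _ => h ν T hν hT u p hmax.1 hLH hdec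

/-- **The Type-I case of stub 3 is a theorem** (rev 5): in the frame, a solution with the Type-I rate
at `T` is strongly `L²`-continuous into `T` (landed
`Theorems.NoTerminalJolt.tendsto_eLpNorm_sub_of_isTypeIBlowup`, Leslie–Shvydkoy 2018 Thm. 1.2 by slice
testing). Recorded so that readers see why `¬ IsTypeIBlowup u T` in `stub_typeIIEnergyEquality` costs
nothing. -/
theorem stub_typeIIEnergyEquality_typeICase :
    ∀ (ν T : ℝ), 0 < ν → 0 < T → ∀ (u : ℝ → EuclideanSpace ℝ (Fin 3) → EuclideanSpace ℝ (Fin 3))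
      (p : ℝ → EuclideanSpace ℝ (Fin 3) → ℝ), IsClassicalNSSolutionOn (Set.Ico 0 T) ν 0 u p →
      IsLerayHopfOn T ν 0 (u 0) u → HasRapidSpatialDecay (u 0) → IsTypeIBlowup u T →
      Filter.Tendsto (fun t => MeasureTheory.eLpNorm (u t - u T) 2 MeasureTheory.volume)
        (nhdsWithin T (Set.Iio T)) (nhds 0) :=
  fun _ _ hν hT _ _ hcl hLH hdec hTI =>
    Summit.NavierStokesRegularity.NavierStokesRegularity.Theorems.NoTerminalJolt.tendsto_eLpNorm_sub_of_isTypeIBlowup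
      hν hT hcl hLH hdec hTI

/-- **Stub 3 ⟺ «no energy jump at ANY first blow-up of the frame»** (rev 5 exactness of the
Type-II/Type-I bookkeeping; landed
`Theorems.NoTerminalJolt.typeIIEnergyEquality_iff_energyEqualityAtBlowup`). -/
theorem stub_typeIIEnergyEquality_iff_energyEqualityAtBlowup :
    (∀ (ν T : ℝ), 0 < ν → 0 < T → ∀ (u : ℝ → EuclideanSpace ℝ (Fin 3) → EuclideanSpace ℝ (Fin 3))
      (p : ℝ → EuclideanSpace ℝ (Fin 3) → ℝ), IsMaximalSmoothSolution ν 0 u p T →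
      IsLerayHopfOn T ν 0 (u 0) u → HasRapidSpatialDecay (u 0) → ¬ IsTypeIBlowup u T →
      Filter.Tendsto (fun t => MeasureTheory.eLpNorm (u t - u T) 2 MeasureTheory.volume)
        (nhdsWithin T (Set.Iio T)) (nhds 0)) ↔
    (∀ (ν T : ℝ), 0 < ν → 0 < T → ∀ (u : ℝ → EuclideanSpace ℝ (Fin 3) → EuclideanSpace ℝ (Fin 3))
      (p : ℝ → EuclideanSpace ℝ (Fin 3) → ℝ), IsMaximalSmoothSolution ν 0 u p T →
      IsLerayHopfOn T ν 0 (u 0) u → HasRapidSpatialDecay (u 0) →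
      Filter.Tendsto (fun t => MeasureTheory.eLpNorm (u t - u T) 2 MeasureTheory.volume)
        (nhdsWithin T (Set.Iio T)) (nhds 0)) :=
  Summit.NavierStokesRegularity.NavierStokesRegularity.Theorems.NoTerminalJolt.typeIIEnergyEquality_iff_energyEqualityAtBlowup

/-- **The enstrophy-mild case of stub 3 is a theorem** (rev 5): in the frame, a solution whose
enstrophy obeys `∫|Du(t)|²_F ≤ M(T−t)^{−α}` near `T` with `M ≥ 0`, `0 < α < 4/5` is strongly
`L²`-continuous into `T` (landed `Theorems.NoTerminalJolt.tendsto_eLpNorm_sub_of_enstrophyRate`). -/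
theorem stub_typeIIEnergyEquality_mildEnstrophyCase :
    ∀ (ν T : ℝ), 0 < ν → 0 < T → ∀ (u : ℝ → EuclideanSpace ℝ (Fin 3) → EuclideanSpace ℝ (Fin 3))
      (p : ℝ → EuclideanSpace ℝ (Fin 3) → ℝ), IsClassicalNSSolutionOn (Set.Ico 0 T) ν 0 u p →
      IsLerayHopfOn T ν 0 (u 0) u → HasRapidSpatialDecay (u 0) →
      ∀ M α : ℝ, 0 ≤ M → 0 < α → α < 4 / 5 →
      (∀ᶠ t in nhdsWithin T (Set.Iio T),
        ∫ x, frobeniusNormSq (fderiv ℝ (u t) x) ≤ M * (T - t) ^ (-α)) →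
      Filter.Tendsto (fun t => MeasureTheory.eLpNorm (u t - u T) 2 MeasureTheory.volume)
        (nhdsWithin T (Set.Iio T)) (nhds 0) :=
  fun _ _ hν hT _ _ hcl hLH hdec _ _ hM hα0 hα hrate =>
    Summit.NavierStokesRegularity.NavierStokesRegularity.Theorems.NoTerminalJolt.tendsto_eLpNorm_sub_of_enstrophyRate
      hν hT hcl hLH hdec hM hα0 hα hrate

/-- **Stub 3 ⟺ «no energy jump at ENSTROPHY-HEAVY non-Type-I first blow-ups»** (rev 5; landed
`Theorems.NoTerminalJolt.typeIIEnergyEquality_iff_enstrophyHeavy`). -/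
theorem stub_typeIIEnergyEquality_iff_enstrophyHeavy :
    (∀ (ν T : ℝ), 0 < ν → 0 < T → ∀ (u : ℝ → EuclideanSpace ℝ (Fin 3) → EuclideanSpace ℝ (Fin 3))
      (p : ℝ → EuclideanSpace ℝ (Fin 3) → ℝ), IsMaximalSmoothSolution ν 0 u p T →
      IsLerayHopfOn T ν 0 (u 0) u → HasRapidSpatialDecay (u 0) → ¬ IsTypeIBlowup u T →
      Filter.Tendsto (fun t => MeasureTheory.eLpNorm (u t - u T) 2 MeasureTheory.volume)
        (nhdsWithin T (Set.Iio T)) (nhds 0)) ↔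
    (∀ (ν T : ℝ), 0 < ν → 0 < T → ∀ (u : ℝ → EuclideanSpace ℝ (Fin 3) → EuclideanSpace ℝ (Fin 3))
      (p : ℝ → EuclideanSpace ℝ (Fin 3) → ℝ), IsMaximalSmoothSolution ν 0 u p T →
      IsLerayHopfOn T ν 0 (u 0) u → HasRapidSpatialDecay (u 0) → ¬ IsTypeIBlowup u T →
      (∀ M α : ℝ, 0 ≤ M → 0 < α → α < 4 / 5 →
        ¬ ∀ᶠ t in nhdsWithin T (Set.Iio T),
          ∫ x, frobeniusNormSq (fderiv ℝ (u t) x) ≤ M * (T - t) ^ (-α)) →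
      Filter.Tendsto (fun t => MeasureTheory.eLpNorm (u t - u T) 2 MeasureTheory.volume)
        (nhdsWithin T (Set.Iio T)) (nhds 0)) :=
  Summit.NavierStokesRegularity.NavierStokesRegularity.Theorems.NoTerminalJolt.typeIIEnergyEquality_iff_enstrophyHeavy

/-- **Stub 3 ⇒ stmt-18118 BY NAME** (rev 5 typed edge; landed
`Theorems.NoTerminalJolt.noFastEnergyConcentration_of_typeIIEnergyEquality`). -/
theorem stub_typeIIEnergyEquality_imp_noFastEnergyConcentration
    (h : ∀ (ν T : ℝ), 0 < ν → 0 < T → ∀ (u : ℝ → EuclideanSpace ℝ (Fin 3) → EuclideanSpace ℝ (Fin 3))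
      (p : ℝ → EuclideanSpace ℝ (Fin 3) → ℝ), IsMaximalSmoothSolution ν 0 u p T →
      IsLerayHopfOn T ν 0 (u 0) u → HasRapidSpatialDecay (u 0) → ¬ IsTypeIBlowup u T →
      Filter.Tendsto (fun t => MeasureTheory.eLpNorm (u t - u T) 2 MeasureTheory.volume)
        (nhdsWithin T (Set.Iio T)) (nhds 0)) :
    Theses.HodographBetchov.NoFastEnergyConcentration :=
  Summit.NavierStokesRegularity.NavierStokesRegularity.Theorems.NoTerminalJolt.noFastEnergyConcentration_of_typeIIEnergyEquality h

/-- **Where stub 2 lives, localised (rev 6): a Type-I first blow-up has a CELL JOLT POINT** — a vertex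
`x₀` and one `δ > 0` such that every parabolic cell `Q_ρ(T, x₀)` contains a slice at self-similar
`L²(B_ρ(x₀))` distance `≥ δ` from the terminal value (landed
`Theorems.NoTerminalJolt.typeI_exists_cellJoltPoint`, `QuarterJoltCellJoltLaw`). So the crux fails
LOCALLY AT the singular point of any Type-I blow-up, not merely somewhere in `ℝ³`. -/
theorem stub_noTypeIBlowup_cellJoltLaw :
    ∀ (ν T : ℝ), 0 < ν → 0 < T → ∀ (u : ℝ → EuclideanSpace ℝ (Fin 3) → EuclideanSpace ℝ (Fin 3))
      (p : ℝ → EuclideanSpace ℝ (Fin 3) → ℝ), IsMaximalSmoothSolution ν 0 u p T →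
      IsLerayHopfOn T ν 0 (u 0) u → HasRapidSpatialDecay (u 0) → IsTypeIBlowup u T →
      ∃ x₀ : EuclideanSpace ℝ (Fin 3), ∃ δ : ℝ, 0 < δ ∧ ∀ ρ : ℝ, 0 < ρ →
        ∃ t ∈ Set.Ioo (T - ρ ^ 2) T,
          δ ≤ (Real.sqrt (T - t))⁻¹ * ∫ x in Metric.ball x₀ ρ, ‖u t x - u T x‖ ^ 2 :=
  fun _ _ hν hT _ _ hmax hLH hdec hTI =>
    Summit.NavierStokesRegularity.NavierStokesRegularity.Theorems.NoTerminalJolt.typeI_exists_cellJoltPoint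
      hν hT hmax hLH hdec hTI

/-- **The route consumes only the LOCAL form of the crux (rev 6)**: `EnstrophyQuarterLaw` (route crux
stmt-1574 BY NAME) and the pointwise-local no-jolt statement («in the frame, every point has a ball on
which the local jolt functional tends to `0`», implied by the crux) already give Clay (A) (landed
`Theorems.navierStokesRegularity_of_enstrophyQuarterLaw_of_localNoTerminalJolt`,
`QuarterJoltLocalNoTerminalJolt`). Conditional; neither hypothesis is claimed. -/
theorem localNoTerminalJolt_suffices (hQ : Theses.QuarterJolt.EnstrophyQuarterLaw)
    (hJloc : ∀ (ν T : ℝ), 0 < ν → 0 < T →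
      ∀ (u : ℝ → EuclideanSpace ℝ (Fin 3) → EuclideanSpace ℝ (Fin 3))
        (p : ℝ → EuclideanSpace ℝ (Fin 3) → ℝ),
        IsClassicalNSSolutionOn (Set.Ico 0 T) ν 0 u p → IsLerayHopfOn T ν 0 (u 0) u →
        HasRapidSpatialDecay (u 0) →
        ∀ x₀ : EuclideanSpace ℝ (Fin 3), ∃ R : ℝ, 0 < R ∧
          Filter.Tendsto
            (fun t : ℝ => (Real.sqrt (T - t))⁻¹ * ∫ x in Metric.ball x₀ R, ‖u t x - u T x‖ ^ 2)
            (nhdsWithin T (Set.Iio T)) (nhds 0)) :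
    NavierStokesRegularity :=
  Summit.NavierStokesRegularity.NavierStokesRegularity.Theorems.navierStokesRegularity_of_enstrophyQuarterLaw_of_localNoTerminalJolt
    hQ hJloc

/-- **The crux implies its local form (rev 6)** (landed `Theorems.localNoTerminalJolt_of_noTerminalJolt`),
so `localNoTerminalJolt_suffices` is a weakening of the route's assembly, not a different route. -/
theorem localNoTerminalJolt_of_noTerminalJolt (h : Theses.QuarterJolt.NoTerminalJolt) :
    ∀ (ν T : ℝ), 0 < ν → 0 < T →
      ∀ (u : ℝ → EuclideanSpace ℝ (Fin 3) → EuclideanSpace ℝ (Fin 3))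
        (p : ℝ → EuclideanSpace ℝ (Fin 3) → ℝ),
        IsClassicalNSSolutionOn (Set.Ico 0 T) ν 0 u p → IsLerayHopfOn T ν 0 (u 0) u →
        HasRapidSpatialDecay (u 0) →
        ∀ x₀ : EuclideanSpace ℝ (Fin 3), ∃ R : ℝ, 0 < R ∧
          Filter.Tendsto
            (fun t : ℝ => (Real.sqrt (T - t))⁻¹ * ∫ x in Metric.ball x₀ R, ‖u t x - u T x‖ ^ 2)
            (nhdsWithin T (Set.Iio T)) (nhds 0) :=
  Summit.NavierStokesRegularity.NavierStokesRegularity.Theorems.localNoTerminalJolt_of_noTerminalJolt h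

/-- **The local form of the crux already gives stub 2's statement (rev 6)**: `LocalNTJ ⇒ NoTypeIBlowup`
(stmt-1217 VERBATIM; landed `Theorems.noTypeIBlowup_of_localNoTerminalJolt`,
`QuarterJoltLocalNoTerminalJoltEdges`). -/
theorem stub_noTypeIBlowup_of_localNoTerminalJolt
    (hJloc : ∀ (ν T : ℝ), 0 < ν → 0 < T →
      ∀ (u : ℝ → EuclideanSpace ℝ (Fin 3) → EuclideanSpace ℝ (Fin 3))
        (p : ℝ → EuclideanSpace ℝ (Fin 3) → ℝ),
        IsClassicalNSSolutionOn (Set.Ico 0 T) ν 0 u p → IsLerayHopfOn T ν 0 (u 0) u →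
        HasRapidSpatialDecay (u 0) →
        ∀ x₀ : EuclideanSpace ℝ (Fin 3), ∃ R : ℝ, 0 < R ∧
          Filter.Tendsto
            (fun t : ℝ => (Real.sqrt (T - t))⁻¹ * ∫ x in Metric.ball x₀ R, ‖u t x - u T x‖ ^ 2)
            (nhdsWithin T (Set.Iio T)) (nhds 0)) :
    ∀ (ν T : ℝ), 0 < ν → 0 < T → ∀ (u : ℝ → EuclideanSpace ℝ (Fin 3) → EuclideanSpace ℝ (Fin 3))
      (p : ℝ → EuclideanSpace ℝ (Fin 3) → ℝ), IsClassicalNSSolutionOn (Set.Ico 0 T) ν 0 u p →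
      IsLerayHopfOn T ν 0 (u 0) u → HasRapidSpatialDecay (u 0) → IsTypeIBlowup u T →
      HasSmoothExtensionPast ν 0 u T :=
  Summit.NavierStokesRegularity.NavierStokesRegularity.Theorems.noTypeIBlowup_of_localNoTerminalJolt hJloc

/-- **18118 gives the LOCAL form of stub 3 (rev 6)**: `NoFastEnergyConcentration` (stmt-18118 BY NAME) ⇒
every frame solution is locally strongly `L²`-continuous into its terminal time — for every `x₀, R`,
`∫_{B(x₀,R)}‖u(t) − u(T)‖² → 0` as `t ↑ T` (landed
`Theorems.localEnergyContinuity_of_noFastEnergyConcentration`, `QuarterJoltNoFastEnergyConcentrationLocalEdges`;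
with `stub_typeIIEnergyEquality_imp_noFastEnergyConcentration`: stub 3 ⇒ 18118 ⇒ local stub 3, the gap
being tightness of `|u(t)|²` at spatial infinity). -/
theorem stub_typeIIEnergyEquality_local_of_noFastEnergyConcentration
    (h : Theses.HodographBetchov.NoFastEnergyConcentration) :
    ∀ (ν T : ℝ), 0 < ν → 0 < T → ∀ (u : ℝ → EuclideanSpace ℝ (Fin 3) → EuclideanSpace ℝ (Fin 3))
      (p : ℝ → EuclideanSpace ℝ (Fin 3) → ℝ), IsClassicalNSSolutionOn (Set.Ico 0 T) ν 0 u p →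
      IsLerayHopfOn T ν 0 (u 0) u → HasRapidSpatialDecay (u 0) →
      ∀ (x₀ : EuclideanSpace ℝ (Fin 3)) (R : ℝ),
        Filter.Tendsto (fun t => ∫⁻ z in Metric.ball x₀ R, ‖u t z - u T z‖ₑ ^ 2)
          (nhdsWithin T (Set.Iio T)) (nhds 0) :=
  Summit.NavierStokesRegularity.NavierStokesRegularity.Theorems.localEnergyContinuity_of_noFastEnergyConcentration h

/-- **Stub 3, conversely (rev 7)**: the crux BY NAME implies `stub_noFastEnergyConcentration`'s
statement (= stmt-18118; landed `Theorems.NoTerminalJolt.noFastEnergyConcentration_of_noTerminalJolt`,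
p632467). So `NoTerminalJolt ⟺ stub_noTypeIBlowup ∧ stub_noFastEnergyConcentration ∧ stub_typeIIRate`,
i.e. `NTJ ⟺ 1217 ∧ 18118 ∧ TypeIIRate`. -/
theorem stub_noFastEnergyConcentration_of_noTerminalJolt (h : Theses.QuarterJolt.NoTerminalJolt) :
    ∀ (ν T : ℝ), 0 < ν → 0 < T → ∀ (u : ℝ → EuclideanSpace ℝ (Fin 3) → EuclideanSpace ℝ (Fin 3))
      (p : ℝ → EuclideanSpace ℝ (Fin 3) → ℝ),
      Literature.Analysis.FluidPDE.IsClassicalNSSolutionOn (Set.Ico 0 T) ν 0 u p →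
      Literature.Analysis.FluidPDE.IsLerayHopfOn T ν 0 (u 0) u →
      Literature.Analysis.FluidPDE.HasRapidSpatialDecay (u 0) → ∀ ε : ℝ, 0 < ε → ∃ l : ℝ, 0 < l ∧
      ∀ t ∈ Set.Ico 0 T, ∫⁻ x in {x : EuclideanSpace ℝ (Fin 3) | l < ‖u t x‖}, ‖u t x‖ₑ ^ 2 ≤
        ENNReal.ofReal ε :=
  Summit.NavierStokesRegularity.NavierStokesRegularity.Theorems.NoTerminalJolt.noFastEnergyConcentration_of_noTerminalJolt h

/-- **The reshape is exact (rev 7)**: the former stub 3 statement ⟺ stmt-18118 (landed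
`Theorems.typeIIEnergyEquality_iff_noFastEnergyConcentration`). -/
theorem stub_typeIIEnergyEquality_iff_noFastEnergyConcentration :
    (∀ (ν T : ℝ), 0 < ν → 0 < T → ∀ (u : ℝ → EuclideanSpace ℝ (Fin 3) → EuclideanSpace ℝ (Fin 3))
      (p : ℝ → EuclideanSpace ℝ (Fin 3) → ℝ), IsMaximalSmoothSolution ν 0 u p T →
      IsLerayHopfOn T ν 0 (u 0) u → HasRapidSpatialDecay (u 0) → ¬ IsTypeIBlowup u T →
      Filter.Tendsto (fun t => MeasureTheory.eLpNorm (u t - u T) 2 MeasureTheory.volume)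
        (nhdsWithin T (Set.Iio T)) (nhds 0)) ↔
    Theses.HodographBetchov.NoFastEnergyConcentration :=
  Summit.NavierStokesRegularity.NavierStokesRegularity.Theorems.typeIIEnergyEquality_iff_noFastEnergyConcentration

/-- **The weak-`L⁴` case of stub 3 is a theorem** (rev 8): in the frame, a solution with
`∫‖u(t)‖⁴ ≤ M/(T−t)` for `t < T` near `T` is strongly `L²`-continuous into `T` (landed
`Theorems.NoTerminalJolt.tendsto_eLpNorm_sub_of_weakL4Rate`, p653319 — the `p = 4` endpoint of
Cheskidov–Luo 2020 Cor. 1.2; contains the Type-I case `stub_typeIIEnergyEquality_typeICase`). -/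
theorem stub_typeIIEnergyEquality_weakL4Case :
    ∀ (ν T : ℝ), 0 < ν → 0 < T → ∀ (u : ℝ → EuclideanSpace ℝ (Fin 3) → EuclideanSpace ℝ (Fin 3))
      (p : ℝ → EuclideanSpace ℝ (Fin 3) → ℝ), IsClassicalNSSolutionOn (Set.Ico 0 T) ν 0 u p →
      IsLerayHopfOn T ν 0 (u 0) u → HasRapidSpatialDecay (u 0) →
      ∀ M : ℝ, (∀ᶠ t in nhdsWithin T (Set.Iio T), ∫ x, ‖u t x‖ ^ 4 ≤ M / (T - t)) →
      Filter.Tendsto (fun t => MeasureTheory.eLpNorm (u t - u T) 2 MeasureTheory.volume)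
        (nhdsWithin T (Set.Iio T)) (nhds 0) :=
  fun _ _ hν hT _ _ hcl hLH hdec _ hrate =>
    Summit.NavierStokesRegularity.NavierStokesRegularity.Theorems.NoTerminalJolt.tendsto_eLpNorm_sub_of_weakL4Rate
      hν hT hcl hLH hdec hrate

/-- **The `L⁴` slice-test criterion case of stub 3 is a theorem** (rev 8, the envelope): in the
frame, `∫⁻_{(t,T)} ofReal ‖u(τ)‖²_{L⁴} dτ ≤ ofReal (C√(T−t))` for `t < T` near `T`, `C ≥ 0`, forces
strong `L²`-continuity into `T` (landed `Theorems.NoTerminalJolt.tendsto_eLpNorm_sub_of_l4Criterion`,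
p652789). -/
theorem stub_typeIIEnergyEquality_l4CriterionCase :
    ∀ (ν T : ℝ), 0 < ν → 0 < T → ∀ (u : ℝ → EuclideanSpace ℝ (Fin 3) → EuclideanSpace ℝ (Fin 3))
      (p : ℝ → EuclideanSpace ℝ (Fin 3) → ℝ), IsClassicalNSSolutionOn (Set.Ico 0 T) ν 0 u p →
      IsLerayHopfOn T ν 0 (u 0) u → HasRapidSpatialDecay (u 0) →
      ∀ C : ℝ, 0 ≤ C →
      (∀ᶠ t in nhdsWithin T (Set.Iio T),
        ∫⁻ τ in Set.Ioo t T, ENNReal.ofReal (Real.sqrt (∫ x, ‖u τ x‖ ^ 4)) ≤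
          ENNReal.ofReal (C * Real.sqrt (T - t))) →
      Filter.Tendsto (fun t => MeasureTheory.eLpNorm (u t - u T) 2 MeasureTheory.volume)
        (nhdsWithin T (Set.Iio T)) (nhds 0) :=
  fun _ _ hν hT _ _ hcl hLH hdec _ hC hcrit =>
    Summit.NavierStokesRegularity.NavierStokesRegularity.Theorems.NoTerminalJolt.tendsto_eLpNorm_sub_of_l4Criterion
      hν hT hcl hLH hdec hC hcrit

/-- **The Shinbrot–Lions case of stub 3 is a theorem** (rev 8): in the frame, `u ∈ L^s(t₀,T; L^r)`
with `r ≥ 4`, `s > 0`, `1/s + 1/r ≤ 1/2` (Shinbrot 1974; `r = s = 4`: Lions 1960) forces strong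
`L²`-continuity into `T` (landed `Theorems.NoTerminalJolt.tendsto_integral_norm_sub_sq_of_shinbrot`,
with the energy-jump law's `eLpNorm` conversion). -/
theorem stub_typeIIEnergyEquality_shinbrotCase :
    ∀ (ν T : ℝ), 0 < ν → 0 < T → ∀ (u : ℝ → EuclideanSpace ℝ (Fin 3) → EuclideanSpace ℝ (Fin 3))
      (p : ℝ → EuclideanSpace ℝ (Fin 3) → ℝ), IsClassicalNSSolutionOn (Set.Ico 0 T) ν 0 u p →
      IsLerayHopfOn T ν 0 (u 0) u → HasRapidSpatialDecay (u 0) →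
      ∀ r s t₀ : ℝ, 4 ≤ r → 0 < s → 1 / s + 1 / r ≤ 1 / 2 → t₀ ∈ Set.Ico 0 T →
      (∫⁻ t in Set.Ioo t₀ T, (∫⁻ x, ‖u t x‖ₑ ^ r) ^ (s / r)) ≠ ⊤ →
      Filter.Tendsto (fun t => MeasureTheory.eLpNorm (u t - u T) 2 MeasureTheory.volume)
        (nhdsWithin T (Set.Iio T)) (nhds 0) :=
  fun _ _ hν hT _ _ hcl hLH hdec _ _ _ hr hs hrs ht₀ hfin =>
    (Summit.NavierStokesRegularity.NavierStokesRegularity.Theorems.NoTerminalJolt.tendsto_eLpNorm_sub_iff_tendsto_integral_norm_sub_sq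
        hT hLH).2
      (Summit.NavierStokesRegularity.NavierStokesRegularity.Theorems.NoTerminalJolt.tendsto_integral_norm_sub_sq_of_shinbrot
        hν hT hcl hLH hdec hr hs hrs ht₀ hfin)

/-- **Stub 3 ⟺ «no energy jump at `L⁴`-HEAVY non-Type-I first blow-ups»** (rev 8 position; landed
`Theorems.NoTerminalJolt.typeIIEnergyEquality_iff_l4Heavy`, p653319): the former stub 3 statement
(⟺ `stub_noFastEnergyConcentration` = stmt-18118) is equivalent to itself restricted to first
blow-ups with `∫‖u(t)‖⁴ ≤ M/(T−t)` near `T` for NO `M ≥ 0`. Both sides OPEN. -/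
theorem stub_typeIIEnergyEquality_iff_l4Heavy :
    (∀ (ν T : ℝ), 0 < ν → 0 < T → ∀ (u : ℝ → EuclideanSpace ℝ (Fin 3) → EuclideanSpace ℝ (Fin 3))
      (p : ℝ → EuclideanSpace ℝ (Fin 3) → ℝ), IsMaximalSmoothSolution ν 0 u p T →
      IsLerayHopfOn T ν 0 (u 0) u → HasRapidSpatialDecay (u 0) → ¬ IsTypeIBlowup u T →
      Filter.Tendsto (fun t => MeasureTheory.eLpNorm (u t - u T) 2 MeasureTheory.volume)
        (nhdsWithin T (Set.Iio T)) (nhds 0)) ↔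
    (∀ (ν T : ℝ), 0 < ν → 0 < T → ∀ (u : ℝ → EuclideanSpace ℝ (Fin 3) → EuclideanSpace ℝ (Fin 3))
      (p : ℝ → EuclideanSpace ℝ (Fin 3) → ℝ), IsMaximalSmoothSolution ν 0 u p T →
      IsLerayHopfOn T ν 0 (u 0) u → HasRapidSpatialDecay (u 0) → ¬ IsTypeIBlowup u T →
      (∀ M : ℝ, 0 ≤ M → ¬ ∀ᶠ t in nhdsWithin T (Set.Iio T), ∫ x, ‖u t x‖ ^ 4 ≤ M / (T - t)) →
      Filter.Tendsto (fun t => MeasureTheory.eLpNorm (u t - u T) 2 MeasureTheory.volume)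
        (nhdsWithin T (Set.Iio T)) (nhds 0)) :=
  Summit.NavierStokesRegularity.NavierStokesRegularity.Theorems.NoTerminalJolt.typeIIEnergyEquality_iff_l4Heavy

/-- **The weak-`L²` majorant case of stub 3 is a theorem** (rev 8; landed
`Theorems.NoTerminalJolt.tendsto_integral_norm_sub_sq_of_weakL2Majorant`, p654851): in the frame, a
majorant `√(∫‖u(τ)‖⁴) ≤ m(τ)` near `T` with `m` a.e.-measurable and WEAKLY square integrable on
`(t₀,T)` (`|{τ ∈ (t₀,T) : λ < m(τ)}| ≤ (N/λ)²` for all `λ > 0`) forces strong `L²`-continuity into `T`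
(Cheskidov–Luo 2020 Thm. 1.1 on the line `2/q + 2/p = 1`, endpoints included; INTERMITTENT TYPE I is
`tendsto_integral_norm_sub_sq_of_weakL2Linfty`). -/
theorem stub_typeIIEnergyEquality_weakL2MajorantCase :
    ∀ (ν T : ℝ), 0 < ν → 0 < T → ∀ (u : ℝ → EuclideanSpace ℝ (Fin 3) → EuclideanSpace ℝ (Fin 3))
      (p : ℝ → EuclideanSpace ℝ (Fin 3) → ℝ), IsClassicalNSSolutionOn (Set.Ico 0 T) ν 0 u p →
      IsLerayHopfOn T ν 0 (u 0) u → HasRapidSpatialDecay (u 0) →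
      ∀ (m : ℝ → ℝ) (t₀ N : ℝ),
      (∀ᶠ τ in nhdsWithin T (Set.Iio T), Real.sqrt (∫ x, ‖u τ x‖ ^ 4) ≤ m τ) → t₀ < T →
      AEMeasurable m (MeasureTheory.volume.restrict (Set.Ioo t₀ T)) → 0 < N →
      (∀ l : ℝ, 0 < l →
        MeasureTheory.volume (Set.Ioo t₀ T ∩ {τ | l < m τ}) ≤ ENNReal.ofReal ((N / l) ^ 2)) →
      Filter.Tendsto (fun t => MeasureTheory.eLpNorm (u t - u T) 2 MeasureTheory.volume)
        (nhdsWithin T (Set.Iio T)) (nhds 0) :=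
  fun _ _ hν hT _ _ hcl hLH hdec _ _ _ hm ht₀ hmeas hN hweak =>
    (Summit.NavierStokesRegularity.NavierStokesRegularity.Theorems.NoTerminalJolt.tendsto_eLpNorm_sub_iff_tendsto_integral_norm_sub_sq
        hT hLH).2
      (Summit.NavierStokesRegularity.NavierStokesRegularity.Theorems.NoTerminalJolt.tendsto_integral_norm_sub_sq_of_weakL2Majorant
        hν hT hcl hLH hdec hm ht₀ hmeas hN hweak)

/-- **Under the route's first crux, stub 3 is a theorem** (rev 8; landed
`Theorems.NoTerminalJolt.noFastEnergyConcentration_of_enstrophyQuarterLaw`, p655816):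
`EnstrophyQuarterLaw (stmt-1574) ⇒ stub_noFastEnergyConcentration (= stmt-18118)`. Conditional on the
OPEN crux stmt-1574. -/
theorem stub_noFastEnergyConcentration_of_enstrophyQuarterLaw
    (hQ : Theses.QuarterJolt.EnstrophyQuarterLaw) : Theses.HodographBetchov.NoFastEnergyConcentration :=
  Summit.NavierStokesRegularity.NavierStokesRegularity.Theorems.NoTerminalJolt.noFastEnergyConcentration_of_enstrophyQuarterLaw
    hQ

/-- **Under the route's first crux, the crux IS stub 2** (rev 8; landed
`Theorems.NoTerminalJolt.iff_noTypeIBlowup_of_enstrophyQuarterLaw`, p655816):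
`EnstrophyQuarterLaw → (NoTerminalJolt ↔ stub_noTypeIBlowup's statement (= stmt-1217))` — stub 3 closes
and `stub_typeIIRate` is vacuous under EQL. The route `QuarterJolt` is `EQL ∧ 1217 ⇒ Clay (A)`. -/
theorem crux_iff_stub_noTypeIBlowup_of_enstrophyQuarterLaw
    (hQ : Theses.QuarterJolt.EnstrophyQuarterLaw) :
    Theses.QuarterJolt.NoTerminalJolt ↔
      (∀ (ν T : ℝ), 0 < ν → 0 < T →
        ∀ (u : ℝ → EuclideanSpace ℝ (Fin 3) → EuclideanSpace ℝ (Fin 3))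
          (p : ℝ → EuclideanSpace ℝ (Fin 3) → ℝ), IsClassicalNSSolutionOn (Set.Ico 0 T) ν 0 u p →
          IsLerayHopfOn T ν 0 (u 0) u → HasRapidSpatialDecay (u 0) → IsTypeIBlowup u T →
          HasSmoothExtensionPast ν 0 u T) :=
  Summit.NavierStokesRegularity.NavierStokesRegularity.Theorems.NoTerminalJolt.iff_noTypeIBlowup_of_enstrophyQuarterLaw
    hQ

/-- **The dissipation-tail case of stub 3 is a theorem** (rev 8; landed
`Theorems.NoTerminalJolt.tendsto_eLpNorm_sub_of_dissipationRate`, p657007/companion): in the frame,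
`∫⁻_{(t,T)}∫⁻|Du|²_F ≤ ofReal (K(T−t)^γ)` for `t < T` near `T` with `K ≥ 0`, `1/5 < γ ≤ 1` forces
strong `L²`-continuity into `T` (⟸ energy `γ`-Hölder at `T⁻`; integrated form of the enstrophy-rate
case `stub_typeIIEnergyEquality_mildEnstrophyCase`). -/
theorem stub_typeIIEnergyEquality_dissipationRateCase :
    ∀ (ν T : ℝ), 0 < ν → 0 < T → ∀ (u : ℝ → EuclideanSpace ℝ (Fin 3) → EuclideanSpace ℝ (Fin 3))
      (p : ℝ → EuclideanSpace ℝ (Fin 3) → ℝ), IsClassicalNSSolutionOn (Set.Ico 0 T) ν 0 u p →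
      IsLerayHopfOn T ν 0 (u 0) u → HasRapidSpatialDecay (u 0) →
      ∀ K γ : ℝ, 0 ≤ K → 1 / 5 < γ → γ ≤ 1 →
      (∀ᶠ t in nhdsWithin T (Set.Iio T),
        ∫⁻ τ in Set.Ioo t T, ∫⁻ x, ENNReal.ofReal (frobeniusNormSq (fderiv ℝ (u τ) x)) ≤
          ENNReal.ofReal (K * (T - t) ^ γ)) →
      Filter.Tendsto (fun t => MeasureTheory.eLpNorm (u t - u T) 2 MeasureTheory.volume)
        (nhdsWithin T (Set.Iio T)) (nhds 0) :=
  fun _ _ hν hT _ _ hcl hLH hdec _ _ hK hγ hγ1 hD =>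
    Summit.NavierStokesRegularity.NavierStokesRegularity.Theorems.NoTerminalJolt.tendsto_eLpNorm_sub_of_dissipationRate
      hν hT hcl hLH hdec hK hγ hγ1 hD

/-- **Under route HalfHolderEnergy's crux, stub 3 is a theorem** (rev 8; landed
`Theorems.NoTerminalJolt.noFastEnergyConcentration_of_energyHalfHolder`):
`EnergyHalfHolder (stmt-25161) ⇒ stub_noFastEnergyConcentration (= stmt-18118)`. Conditional on the
OPEN crux stmt-25161. -/
theorem stub_noFastEnergyConcentration_of_energyHalfHolder
    (hH : Theses.HalfHolderEnergy.EnergyHalfHolder) : Theses.HodographBetchov.NoFastEnergyConcentration :=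
  Summit.NavierStokesRegularity.NavierStokesRegularity.Theorems.NoTerminalJolt.noFastEnergyConcentration_of_energyHalfHolder
    hH

/-- **Summary position (rev 8)**: the former stub 3 ⟺ itself restricted to first blow-ups that are
simultaneously non-Type-I, ENSTROPHY-HEAVY (no rate `M(T−t)^{−α}`, `α < 4/5`) and `L⁴`-HEAVY (no rate
`∫‖u(t)‖⁴ ≤ M/(T−t)`) (landed `Theorems.NoTerminalJolt.typeIIEnergyEquality_iff_allHeavy`, p656357). -/
theorem stub_typeIIEnergyEquality_iff_allHeavy :
    (∀ (ν T : ℝ), 0 < ν → 0 < T → ∀ (u : ℝ → EuclideanSpace ℝ (Fin 3) → EuclideanSpace ℝ (Fin 3))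
      (p : ℝ → EuclideanSpace ℝ (Fin 3) → ℝ), IsMaximalSmoothSolution ν 0 u p T →
      IsLerayHopfOn T ν 0 (u 0) u → HasRapidSpatialDecay (u 0) → ¬ IsTypeIBlowup u T →
      Filter.Tendsto (fun t => MeasureTheory.eLpNorm (u t - u T) 2 MeasureTheory.volume)
        (nhdsWithin T (Set.Iio T)) (nhds 0)) ↔
    (∀ (ν T : ℝ), 0 < ν → 0 < T → ∀ (u : ℝ → EuclideanSpace ℝ (Fin 3) → EuclideanSpace ℝ (Fin 3))
      (p : ℝ → EuclideanSpace ℝ (Fin 3) → ℝ), IsMaximalSmoothSolution ν 0 u p T →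
      IsLerayHopfOn T ν 0 (u 0) u → HasRapidSpatialDecay (u 0) → ¬ IsTypeIBlowup u T →
      (∀ M α : ℝ, 0 ≤ M → 0 < α → α < 4 / 5 →
        ¬ ∀ᶠ t in nhdsWithin T (Set.Iio T),
          ∫ x, frobeniusNormSq (fderiv ℝ (u t) x) ≤ M * (T - t) ^ (-α)) →
      (∀ M : ℝ, ¬ ∀ᶠ t in nhdsWithin T (Set.Iio T), ∫ x, ‖u t x‖ ^ 4 ≤ M / (T - t)) →
      Filter.Tendsto (fun t => MeasureTheory.eLpNorm (u t - u T) 2 MeasureTheory.volume)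
        (nhdsWithin T (Set.Iio T)) (nhds 0)) :=
  Summit.NavierStokesRegularity.NavierStokesRegularity.Theorems.NoTerminalJolt.typeIIEnergyEquality_iff_allHeavy

end Summit.NavierStokesRegularity.NavierStokesRegularity.Cruxes.NoTerminalJolt.RegularSplit
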